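import Literature.AlgebraicGeometry.HodgeTheory.FermatEvenMiddleBettiNumber
import Literature.AlgebraicGeometry.HodgeTheory.DiagonalElementEigenspaces
import HarnessLib

/-!
# Eigenspaces of one element of `μₘ²ʳ⁺²` on `H²ʳ(X²ʳₘ(ℂ); ℂ)`: `dim ker (g_a^* − μ) = #{α ∈ 𝔄²ʳₘ : χ_α(a) = μ} + [μ = 1]`
# (Shioda 1979 §1 (1.3)–(1.4) read for a single symmetry; Katz 2009 §3)

Family `hodge`, layer `Literature/AlgebraicGeometry/HodgeTheory`. PROOF FILE (theorems only: no definition, no named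
fact; D-0026 net debt `0`). The even-dimensional companion of `finrank_eigenspace_diagonalPullback_fermat_odd_eq_card`
(file `FermatOddMiddleBettiNumber`): for the Fermat variety `X²ʳₘ` (`r, m ≥ 1`), one diagonal symmetry `a ∈ μₘ²ʳ⁺²` and
`μ ∈ ℂ`, the `μ`-eigenspace of `g_a^*` on the middle cohomology is `⊕ {V(α) : χ_α(a) = μ}`
(`eigenspace_diagonalPullback_fermat_eq_iSup`), and `dim V(α) = 1` on `𝔄²ʳₘ ∪ {0}`, `0` elsewhere
(`finrank_fermatEigenspace_eq_one_of_forall_ne_zero`, `finrank_fermatEigenspace_zero_eq_one`,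
`finrank_fermatEigenspace_eq_zero_of_not`); the trivial character contributes the ambient class `hʳ` to the eigenvalue
`μ = 1` (T. Shioda, Math. Ann. 245 (1979), §1: `H²ʳ = ⊕_{α ∈ 𝔄} V(α) ⊕ ℂ·hʳ`; N. M. Katz, *Another look at the Dwork
family* (2009), §3: eigendecomposition under a group acting on the family).

* `finrank_iSup_fermatEigenspace_even_eq_card` — `dim ⨆_{α ∈ A} V(α) = #(A ∩ 𝔄²ʳₘ) + [0 ∈ A]`.
* **`finrank_eigenspace_diagonalPullback_fermat_even_eq_card`** — `dim ker (g_a^* − μ) = #{α ∈ 𝔄²ʳₘ : χ_α(a) = μ} + [μ = 1]`.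

Written by the prover seat `hodge-nonav-19716-p2` (g5, cell `hodge-nonav`).

## References

* [Shioda1979HodgeFermat] T. Shioda, The Hodge conjecture for Fermat varieties, Math. Ann. 245 (1979), §1 (1.3)–(1.4).
* [Katz2009] N. M. Katz, Another look at the Dwork family, Progr. Math. 269 (2009), §3.
-/

noncomputable section

open CategoryTheory AlgebraicGeometry

namespace Literature.AlgebraicGeometry.HodgeTheory

open Literature.AlgebraicGeometry.Motives Literature.AlgebraicTopology.SingularHomology

variable {m : ℕ}

/-- `dim (⨆ᵢ Aᵢ) = Σᵢ dim Aᵢ` for an independent finite family of subspaces (plumbing). [folklore] -/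
private theorem finrank_iSup_eq_sum_of_iSupIndep₃ {K M : Type*} [Field K] [AddCommGroup M] [Module K M]
    {ι : Type*} [Fintype ι] (B : ι → Submodule K M) (hB : iSupIndep B) [∀ i, Module.Finite K (B i)] :
    Module.finrank K ↥(⨆ i, B i) = ∑ i, Module.finrank K (B i) := by
  classical
  have hinj := hB.dfinsupp_lsum_injective
  have hrange : LinearMap.range (DFinsupp.lsum ℕ (M := fun i => ↥(B i)) fun i => (B i).subtype) = ⨆ i, B i :=
    (Submodule.iSup_eq_range_dfinsupp_lsum B).symm
  rw [← hrange, LinearMap.finrank_range_of_inj hinj, ← Module.finrank_directSum]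
  rfl

/-- **`dim (⨆_{α ∈ A} V(α)) = #(A ∩ 𝔄²ʳₘ) + [0 ∈ A]`** for any set `A` of characters of the even-dimensional Fermat variety
(`r, m ≥ 1`): the `V(α)` are independent, lines on `𝔄²ʳₘ ∪ {0}` and zero elsewhere.
[cite: Shioda1979HodgeFermat, §1 (1.3)–(1.4)] -/
theorem finrank_iSup_fermatEigenspace_even_eq_card [NeZero m] {r : ℕ} (hr : 1 ≤ r)
    (A : Set (Fin (2 * r + 2) → ZMod m)) [DecidablePred (· ∈ A)] :
    Module.finrank ℂ ↥(⨆ α : A, fermatEigenspace m α.1 (2 * r)) =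
      Fintype.card {α : Fin (2 * r + 2) → ZMod m // α ∈ A ∧ (∀ i, α i ≠ 0) ∧ ∑ i, α i = 0} +
        (if (0 : Fin (2 * r + 2) → ZMod m) ∈ A then 1 else 0) := by
  classical
  have hm : 1 ≤ m := NeZero.one_le
  have hX : IsSmoothProjective (2 * r) (fermatHypersurface (2 * r) m) :=
    isSmoothProjective_fermatHypersurface (by omega) hm
  haveI := finite_complexBetti hX (2 * r)
  have hind : iSupIndep fun α : A ↦ fermatEigenspace m α.1 (2 * r) :=
    (iSupIndep_fermatEigenspace (n := 2 * r) (m := m) (2 * r)).comp Subtype.val_injective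
  have hdim : ∀ α : Fin (2 * r + 2) → ZMod m, Module.finrank ℂ ↥(fermatEigenspace m α (2 * r)) =
      (if (∀ i, α i ≠ 0) ∧ ∑ i, α i = 0 then 1 else 0) + (if α = 0 then 1 else 0) := by
    intro α
    by_cases hgood : (∀ i, α i ≠ 0) ∧ ∑ i, α i = 0
    · have hα0 : α ≠ 0 := fun h ↦ hgood.1 0 (by rw [h]; rfl)
      rw [if_pos hgood, if_neg hα0, finrank_fermatEigenspace_eq_one_of_forall_ne_zero hr hgood.1 hgood.2]
    · rw [if_neg hgood, zero_add]
      by_cases h0 : α = 0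
      · rw [if_pos h0, h0]; exact finrank_fermatEigenspace_zero_eq_one hm hr
      · rw [if_neg h0]; exact finrank_fermatEigenspace_eq_zero_of_not hm hr h0 hgood
  rw [finrank_iSup_eq_sum_of_iSupIndep₃ _ hind]
  simp_rw [hdim]
  rw [Finset.sum_add_distrib, Finset.sum_boole, Finset.sum_boole, ← Fintype.card_subtype]
  congr 1
  · exact Fintype.card_congr (Equiv.subtypeSubtypeEquivSubtypeInter (fun α : Fin (2 * r + 2) → ZMod m ↦ α ∈ A)
      (fun α ↦ (∀ i, α i ≠ 0) ∧ ∑ i, α i = 0))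
  · simp only [Nat.cast_id]
    by_cases h0 : (0 : Fin (2 * r + 2) → ZMod m) ∈ A
    · rw [if_pos h0, Finset.card_eq_one]
      exact ⟨⟨0, h0⟩, by ext ⟨α, hα⟩; simp⟩
    · rw [if_neg h0, Finset.card_eq_zero, Finset.filter_eq_empty_iff]
      rintro ⟨α, hα⟩ _ h
      exact h0 (by simpa [← h] using hα)

/-- **Eigenspaces of ONE element of `μₘ²ʳ⁺²` on `H²ʳ(X²ʳₘ(ℂ); ℂ)`**: for `a ∈ μₘ²ʳ⁺²` and `μ ∈ ℂ`,
`dim ker (g_a^* − μ) = #{α ∈ 𝔄²ʳₘ : χ_α(a) = μ} + [μ = 1]` (`r, m ≥ 1`) — the eigenspace is `⊕ {V(α) : χ_α(a) = μ}`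
(`eigenspace_diagonalPullback_fermat_eq_iSup`), each admissible `V(α)` and `V(0) = ℂ·hʳ` a line (the latter with
`χ_0(a) = 1`). Companion of `finrank_eigenspace_diagonalPullback_fermat_odd_eq_card`.
[cite: Shioda1979HodgeFermat, §1 (1.3)–(1.4)] [cite: Katz2009, §3] -/
theorem finrank_eigenspace_diagonalPullback_fermat_even_eq_card [NeZero m] {r : ℕ} (hr : 1 ≤ r)
    (a : fermatGroup (2 * r) m) (μ : ℂ) :
    Module.finrank ℂ ↥(Module.End.eigenspace
        (diagonalPullback (fermatPolynomial ℂ (2 * r) m) (fermatGroup_le_diagonalStabilizer m a.2) (2 * r)) μ) =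
      Fintype.card {α : Fin (2 * r + 2) → ZMod m //
        ((fermatCharacter m α a : ℂˣ) : ℂ) = μ ∧ (∀ i, α i ≠ 0) ∧ ∑ i, α i = 0} + (if μ = 1 then 1 else 0) := by
  classical
  rw [eigenspace_diagonalPullback_fermat_eq_iSup]
  have h := finrank_iSup_fermatEigenspace_even_eq_card hr {α | ((fermatCharacter m α a : ℂˣ) : ℂ) = μ}
  refine Eq.trans h ?_
  have h1 : ((fermatCharacter m (0 : Fin (2 * r + 2) → ZMod m) a : ℂˣ) : ℂ) = 1 := by
    simp [fermatCharacter_apply]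
  congr 1
  simp only [Set.mem_setOf_eq, h1]
  by_cases hμ : μ = 1
  · rw [if_pos hμ, if_pos hμ.symm]
  · rw [if_neg hμ, if_neg (Ne.symm hμ)]

end Literature.AlgebraicGeometry.HodgeTheory

end
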